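import Mathlib
import Summits.AtomisticToContinuum.Crystallization.Theorems.ChartedPlanarOrderPatternExtraction

/-!
# Window exactness from matching at every tolerance (piece X of node «CoerciveStraightening», part 2)

Helper for the residual crux `ChartedPlanarOrder.ChartedZeroExcessLayered`
(stmt-AtomisticToContinuum-26636; decomposition cell decomp-a2c, lens-3, generation 11).

`windowExactOfMatched` (deterministic metric geometry, TRUE-type piece X of the node, verbatim): a point
`q` of a `δ`-separated set `Y ⊆ ℝ³` which, for EVERY `η > 0`, is `η`-matched (configuration → pattern
within radius `4 b_η`, pattern → configuration within radius `5 b_η`) to a flexible-gap layered Barlow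
pattern of some admissible scale `b_η ∈ [9/10, 1]` coincides EXACTLY with such a pattern within radius
`3 b` for some admissible `b`. Proof: `ChartedPlanarOrderPatternExtraction.extraction` + `intBox`
(integer data of pattern points of norm `≤ 5` lie in a finite box) + `sepClosed` (separated sets are
closed); (→) pigeonhole on the integer data of the matching pattern points and uniqueness of limits,
(←) approximating pattern points are eventually inside radius `5 b_n`, their matched configuration
points converge, and `Y` is closed. [folklore compactness]
-/

namespace Summit.AtomisticToContinuum.Crystallization.Theorems.ChartedPlanarOrderWindowExactOfMatched

open Filter Topology Literature.MathematicalPhysics.StatisticalMechanics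
open Summit.AtomisticToContinuum.Crystallization.Theorems.ChartedPlanarOrderPatternExtraction

/-! ### helpers -/

/-- a coordinate is bounded by the Euclidean norm. -/
theorem abs_apply_le_norm' (v : EuclideanSpace ℝ (Fin 3)) (k : Fin 3) : |v k| ≤ ‖v‖ := by
  have h := EuclideanSpace.norm_sq_eq v
  have : ‖v k‖ ^ 2 ≤ ∑ i, ‖v i‖ ^ 2 :=
    Finset.single_le_sum (f := fun i => ‖v i‖ ^ 2) (fun i _ => sq_nonneg _) (Finset.mem_univ k)
  rw [← h, Real.norm_eq_abs] at this
  exact abs_le_of_sq_le_sq (by simpa using this) (norm_nonneg _)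

/-- `|L m| ≤ |m|` for the label function of a Hägg sequence. -/
theorem abs_haggLabel_le (s : ℤ → ℤ) (hs : Literature.MathematicalPhysics.StatisticalMechanics.IsHaggSeq s) :
    ∀ m : ℤ, |Literature.MathematicalPhysics.StatisticalMechanics.haggLabel s m| ≤ |m| := by
  have hpos : ∀ n : ℕ, -(n:ℤ) ≤ Literature.MathematicalPhysics.StatisticalMechanics.haggLabel s n ∧
      Literature.MathematicalPhysics.StatisticalMechanics.haggLabel s n ≤ n := by
    intro n
    induction n with
    | zero => simp
    | succ n ih =>
      have hrec : Literature.MathematicalPhysics.StatisticalMechanics.haggLabel s ((n+1 : ℕ) : ℤ) =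
          Literature.MathematicalPhysics.StatisticalMechanics.haggLabel s (n:ℤ) + s n := by
        rw [← Literature.MathematicalPhysics.StatisticalMechanics.haggLabel_succ]; push_cast; ring_nf
      rcases hs n with h | h <;> · rw [h] at hrec; push_cast at hrec ⊢; omega
  have hneg : ∀ n : ℕ, -(n:ℤ) ≤ Literature.MathematicalPhysics.StatisticalMechanics.haggLabel s (-(n:ℤ)) ∧
      Literature.MathematicalPhysics.StatisticalMechanics.haggLabel s (-(n:ℤ)) ≤ n := by
    intro n
    induction n with
    | zero => simp
    | succ n ih =>
      have hrec : Literature.MathematicalPhysics.StatisticalMechanics.haggLabel s (-(n:ℤ)) =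
          Literature.MathematicalPhysics.StatisticalMechanics.haggLabel s (-((n+1 : ℕ) : ℤ)) + s (-((n+1 : ℕ):ℤ)) := by
        rw [← Literature.MathematicalPhysics.StatisticalMechanics.haggLabel_succ]; congr 1; push_cast; ring
      rcases hs (-((n+1 : ℕ):ℤ)) with h | h <;> · rw [h] at hrec; push_cast at hrec ⊢; omega
  intro m
  rcases le_or_gt 0 m with hm | hm
  · lift m to ℕ using hm; rw [Nat.abs_cast]; exact abs_le.2 (hpos m)
  · obtain ⟨n, rfl⟩ : ∃ n : ℕ, m = -(n:ℤ) := ⟨(-m).toNat, by omega⟩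
    rw [abs_neg, Nat.abs_cast]; exact abs_le.2 (hneg n)

/-- **Integer box**: pattern points of norm `≤ 5` have integer data `|m| ≤ 7`, `|i|, |j| ≤ 30`. -/
theorem intBox :
    ∀ (b : ℝ), 9 / 10 ≤ b ∧ b ≤ 1 → ∀ (A : EuclideanSpace ℝ (Fin 3) →ₗᵢ[ℝ] EuclideanSpace ℝ (Fin 3)) (s : ℤ → ℤ) (z : ℤ → ℝ), Literature.MathematicalPhysics.StatisticalMechanics.IsHaggSeq s → (∀ m : ℤ, 39 / 50 * b ≤ z (m + 1) - z m ∧ z (m + 1) - z m ≤ 17 / 20 * b) ∧ z 0 = 0 → ∀ m i j : ℤ, ‖A (((i : ℝ) • Literature.MathematicalPhysics.StatisticalMechanics.triangularVec₁ b) + ((j : ℝ) • Literature.MathematicalPhysics.StatisticalMechanics.triangularVec₂ b) + ((Literature.MathematicalPhysics.StatisticalMechanics.haggLabel s m : ℝ) • Literature.MathematicalPhysics.StatisticalMechanics.barlowOffset b) + (z m • Literature.MathematicalPhysics.StatisticalMechanics.layerNormal 1))‖ ≤ 5 → |m| ≤ 7 ∧ |i| ≤ 30 ∧ |j| ≤ 30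 := by
  intro b hb A s z hs hz m i j hnorm
  rw [LinearIsometry.norm_map] at hnorm
  set v : EuclideanSpace ℝ (Fin 3) := (((i : ℝ) • Literature.MathematicalPhysics.StatisticalMechanics.triangularVec₁ b) + ((j : ℝ) • Literature.MathematicalPhysics.StatisticalMechanics.triangularVec₂ b) + ((Literature.MathematicalPhysics.StatisticalMechanics.haggLabel s m : ℝ) • Literature.MathematicalPhysics.StatisticalMechanics.barlowOffset b) + (z m • Literature.MathematicalPhysics.StatisticalMechanics.layerNormal 1)) with hv
  have hv2 : v 2 = z m := by
    rw [hv]; simp [Literature.MathematicalPhysics.StatisticalMechanics.triangularVec₁,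
      Literature.MathematicalPhysics.StatisticalMechanics.triangularVec₂,
      Literature.MathematicalPhysics.StatisticalMechanics.barlowOffset,
      Literature.MathematicalPhysics.StatisticalMechanics.layerNormal]
  have hv0 : v 0 = b * (i + j / 2 + Literature.MathematicalPhysics.StatisticalMechanics.haggLabel s m / 2) := by
    rw [hv]; simp [Literature.MathematicalPhysics.StatisticalMechanics.triangularVec₁,
      Literature.MathematicalPhysics.StatisticalMechanics.triangularVec₂,
      Literature.MathematicalPhysics.StatisticalMechanics.barlowOffset,
      Literature.MathematicalPhysics.StatisticalMechanics.layerNormal]; ring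
  have hv1 : v 1 = b * √3 / 2 * (j + Literature.MathematicalPhysics.StatisticalMechanics.haggLabel s m / 3) := by
    rw [hv]; simp [Literature.MathematicalPhysics.StatisticalMechanics.triangularVec₁,
      Literature.MathematicalPhysics.StatisticalMechanics.triangularVec₂,
      Literature.MathematicalPhysics.StatisticalMechanics.barlowOffset,
      Literature.MathematicalPhysics.StatisticalMechanics.layerNormal]; ring
  have hc2 := abs_apply_le_norm' v 2
  have hc0 := abs_apply_le_norm' v 0
  have hc1 := abs_apply_le_norm' v 1
  rw [hv2] at hc2
  rw [hv0] at hc0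
  rw [hv1] at hc1
  have hb0 : 0 < b := by linarith [hb.1]
  -- heights grow at least linearly
  have hup : ∀ n : ℕ, (n : ℝ) * (39 / 50 * b) ≤ z n := by
    intro n
    induction n with
    | zero => simp [hz.2]
    | succ n ih =>
      have := (hz.1 n).1
      push_cast; linarith
  have hdn : ∀ n : ℕ, z (-(n:ℤ)) ≤ -((n : ℝ) * (39 / 50 * b)) := by
    intro n
    induction n with
    | zero => simp [hz.2]
    | succ n ih =>
      have h' := (hz.1 (-((n+1 : ℕ) : ℤ))).1
      rw [show (-((n+1 : ℕ) : ℤ) + 1) = -(n:ℤ) by push_cast; ring] at h'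
      push_cast at h' ⊢; linarith
  have hmb : |(m : ℝ)| * (39 / 50 * b) ≤ 5 := by
    rcases le_or_gt 0 m with h0 | h0
    · have h1 := hup m.toNat
      rw [show ((m.toNat : ℕ) : ℤ) = m by omega] at h1
      have h2 : |(m : ℝ)| = ((m.toNat : ℕ) : ℝ) := by
        rw [abs_of_nonneg (by exact_mod_cast h0)]
        exact_mod_cast (show m = ((m.toNat : ℕ) : ℤ) by omega)
      rw [h2]; linarith [le_abs_self (z m)]
    · have h1 := hdn (-m).toNat
      rw [show (-(((-m).toNat : ℕ) : ℤ)) = m by omega] at h1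
      have h2 : |(m : ℝ)| = (((-m).toNat : ℕ) : ℝ) := by
        rw [abs_of_neg (by exact_mod_cast h0)]
        exact_mod_cast (show -m = (((-m).toNat : ℕ) : ℤ) by omega)
      rw [h2]; linarith [neg_le_abs (z m)]
  have hm7 : |m| ≤ 7 := by
    by_contra hcon
    replace hcon := not_le.mp hcon
    have h8z : (8 : ℤ) ≤ |m| := by have := Int.lt_iff_add_one_le.mp hcon; linarith
    have h8 : (8 : ℝ) ≤ |(m : ℝ)| := by rw [← Int.cast_abs]; exact_mod_cast h8z
    have := mul_le_mul_of_nonneg_right h8 (by linarith : (0:ℝ) ≤ 39 / 50 * b)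
    linarith [hb.1]
  -- label bound
  have hL : |(Literature.MathematicalPhysics.StatisticalMechanics.haggLabel s m : ℝ)| ≤ 7 := by
    have h' : |Literature.MathematicalPhysics.StatisticalMechanics.haggLabel s m| ≤ 7 :=
      le_trans (abs_haggLabel_le s hs m) hm7
    have h'' : ((|Literature.MathematicalPhysics.StatisticalMechanics.haggLabel s m| : ℤ) : ℝ) ≤ 7 := by
      exact_mod_cast h'
    rwa [Int.cast_abs] at h''
  obtain ⟨hL1, hL2⟩ := abs_le.1 hL
  have hs3 : (17:ℝ) / 10 ≤ √3 := by
    have := Real.sqrt_le_sqrt (show ((17:ℝ)/10) ^ 2 ≤ 3 by norm_num)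
    rwa [Real.sqrt_sq (by norm_num)] at this
  -- j bound
  have hj : |(j : ℝ)| ≤ 30 := by
    rw [abs_mul, abs_of_pos (by positivity : (0:ℝ) < b * √3 / 2)] at hc1
    have hA : |(j:ℝ) + Literature.MathematicalPhysics.StatisticalMechanics.haggLabel s m / 3| * (3 / 4) ≤
        |(j:ℝ) + Literature.MathematicalPhysics.StatisticalMechanics.haggLabel s m / 3| * (b * √3 / 2) := by
      apply mul_le_mul_of_nonneg_left _ (abs_nonneg _); nlinarith [hb.1, hs3]
    have hB : |(j:ℝ) + Literature.MathematicalPhysics.StatisticalMechanics.haggLabel s m / 3| ≤ 7 := by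
      nlinarith [hc1, hnorm, abs_nonneg ((j:ℝ) + Literature.MathematicalPhysics.StatisticalMechanics.haggLabel s m / 3)]
    obtain ⟨hB1, hB2⟩ := abs_le.1 hB
    rw [abs_le]; constructor <;> linarith
  -- i bound
  have hi : |(i : ℝ)| ≤ 30 := by
    rw [abs_mul, abs_of_pos hb0] at hc0
    have hA : |(i:ℝ) + j / 2 + Literature.MathematicalPhysics.StatisticalMechanics.haggLabel s m / 2| * (9 / 10) ≤
        |(i:ℝ) + j / 2 + Literature.MathematicalPhysics.StatisticalMechanics.haggLabel s m / 2| * b :=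
      mul_le_mul_of_nonneg_left hb.1 (abs_nonneg _)
    have hB : |(i:ℝ) + j / 2 + Literature.MathematicalPhysics.StatisticalMechanics.haggLabel s m / 2| ≤ 6 := by
      nlinarith [hc0, hnorm, abs_nonneg ((i:ℝ) + j / 2 + Literature.MathematicalPhysics.StatisticalMechanics.haggLabel s m / 2)]
    obtain ⟨hB1, hB2⟩ := abs_le.1 hB
    obtain ⟨hj1, hj2⟩ := abs_le.1 hj
    rw [abs_le]; constructor <;> linarith
  refine ⟨hm7, ?_, ?_⟩
  · have : ((|i| : ℤ) : ℝ) ≤ 30 := by rw [Int.cast_abs]; exact hi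
    exact_mod_cast this
  · have : ((|j| : ℤ) : ℝ) ≤ 30 := by rw [Int.cast_abs]; exact hj
    exact_mod_cast this

/-- **Separated sets are closed** (sequential form). -/
theorem sepClosed :
    ∀ δ : ℝ, 0 < δ → ∀ Y : Set (EuclideanSpace ℝ (Fin 3)), (∀ x ∈ Y, ∀ y ∈ Y, x ≠ y → δ ≤ dist x y) → ∀ p : EuclideanSpace ℝ (Fin 3), (∀ ε : ℝ, 0 < ε → ∃ x ∈ Y, dist x p < ε) → p ∈ Y := by
  intro δ hδ Y hY p h
  obtain ⟨x₁, hx₁, hd₁⟩ := h (δ / 2) (by positivity)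
  have hx : x₁ = p := by
    apply eq_of_forall_dist_le
    intro ε hε
    obtain ⟨x', hx', hd'⟩ := h (min ε (δ / 2)) (lt_min hε (by positivity))
    have hxx : x₁ = x' := by
      by_contra hne
      have h1 := hY x₁ hx₁ x' hx' hne
      have h2 := dist_triangle x₁ p x'
      have h3 : dist x' p < δ / 2 := lt_of_lt_of_le hd' (min_le_right _ _)
      rw [dist_comm x' p] at h3
      linarith
    subst hxx
    exact le_of_lt (lt_of_lt_of_le hd' (min_le_left _ _))
  exact hx ▸ hx₁

/-- **Piece X `WindowExactOfMatched` of node «CoerciveStraightening» (verbatim).** -/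
theorem windowExactOfMatched :
    ∀ δ : ℝ, 0 < δ → ∀ Y : Set (EuclideanSpace ℝ (Fin 3)), (∀ x ∈ Y, ∀ y ∈ Y, x ≠ y → δ ≤ dist x y) → ∀ q ∈ Y, (∀ η : ℝ, 0 < η → ∃ b : ℝ, 9 / 10 ≤ b ∧ b ≤ 1 ∧ ∃ (A : EuclideanSpace ℝ (Fin 3) →ₗᵢ[ℝ] EuclideanSpace ℝ (Fin 3)) (s : ℤ → ℤ) (z : ℤ → ℝ), Literature.MathematicalPhysics.StatisticalMechanics.IsHaggSeq s ∧ (∀ m : ℤ, 39 / 50 * b ≤ z (m + 1) - z m ∧ z (m + 1) - z m ≤ 17 / 20 * b) ∧ z 0 = 0 ∧ (∀ y : EuclideanSpace ℝ (Fin 3), dist y q ≤ 4 * b → y ∈ Y → ∃ y' : EuclideanSpace ℝ (Fin 3), y' - q ∈ {p | ∃ m i j : ℤ, p = A (((i : ℝ) • Literature.MathematicalPhysics.StatisticalMechanics.triangularVec₁ b) + ((j : ℝ) • Literature.MathematicalPhysics.StatisticalMechanics.triangularVec₂ b) + ((Literature.MathematicalPhysics.StatisticalMechanics.haggLabel s m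 : ℝ) • Literature.MathematicalPhysics.StatisticalMechanics.barlowOffset b) + (z m • Literature.MathematicalPhysics.StatisticalMechanics.layerNormal 1))} ∧ dist y y' ≤ η) ∧ (∀ y' : EuclideanSpace ℝ (Fin 3), y' - q ∈ {p | ∃ m i j : ℤ, p = A (((i : ℝ) • Literature.MathematicalPhysics.StatisticalMechanics.triangularVec₁ b) + ((j : ℝ) • Literature.MathematicalPhysics.StatisticalMechanics.triangularVec₂ b) + ((Literature.MathematicalPhysics.StatisticalMechanics.haggLabel s m : ℝ) • Literature.MathematicalPhysics.StatisticalMechanics.barlowOffset b) + (z m • Literature.MathematicalPhysics.StatisticalMechanics.layerNormal 1))} → dist y' q ≤ 5 * b → ∃ y : EuclideanSpace ℝ (Fin 3), y ∈ Y ∧ dist y y' ≤ η)) → ∃ b : ℝ, 9 / 10 ≤ b ∧ b ≤ 1 ∧ ∃ (A : EuclideanSpace ℝ (Fin 3) →ₗᵢ[ℝ] EuclideanSpace ℝ (Fin 3)) (s : ℤ → ℤ) (z : ℤ → ℝ), Literature.MathematicalPhysics.StatisticalMechanics.IsHaggSeq s ∧ (∀ m : ℤ, 39 / 50 * b ≤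 z (m + 1) - z m ∧ z (m + 1) - z m ≤ 17 / 20 * b) ∧ z 0 = 0 ∧ ∀ y : EuclideanSpace ℝ (Fin 3), dist y q ≤ 3 * b → (y ∈ Y ↔ y - q ∈ {p | ∃ m i j : ℤ, p = A (((i : ℝ) • Literature.MathematicalPhysics.StatisticalMechanics.triangularVec₁ b) + ((j : ℝ) • Literature.MathematicalPhysics.StatisticalMechanics.triangularVec₂ b) + ((Literature.MathematicalPhysics.StatisticalMechanics.haggLabel s m : ℝ) • Literature.MathematicalPhysics.StatisticalMechanics.barlowOffset b) + (z m • Literature.MathematicalPhysics.StatisticalMechanics.layerNormal 1))}) := by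
  intro δ hδ Y hY q hq hgood
  have hηpos : ∀ n : ℕ, (0 : ℝ) < 1 / ((n : ℝ) + 1) := fun n => by positivity
  choose bs hb1 hb2 As ss zs hss hgap hz0 h1 h2 using fun n : ℕ => hgood (1 / ((n : ℝ) + 1)) (hηpos n)
  obtain ⟨φ, hφ, b, hbW, hbt, A, s, z, hs, hgz, hzz, hconv⟩ :=
    extraction bs As ss zs (fun n => ⟨hb1 n, hb2 n⟩) hss (fun n => ⟨hgap n, hz0 n⟩)
  -- tolerances along the subsequence tend to zero
  have hηt : Tendsto (fun n : ℕ => 1 / (((φ n : ℕ) : ℝ) + 1)) atTop (𝓝 0) :=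
    tendsto_one_div_add_atTop_nhds_zero_nat.comp hφ.tendsto_atTop
  refine ⟨b, hbW.1, hbW.2, A, s, z, hs, hgz, hzz, fun y hyq => ⟨fun hyY => ?_, fun hyP => ?_⟩⟩
  · -- (→) configuration point ⟹ limit pattern point
    have hle4 : ∀ n : ℕ, dist y q ≤ 4 * bs (φ n) := by
      intro n; have := hb1 (φ n); have := hbW.2; linarith
    choose ys hys hdy using fun n : ℕ => h1 (φ n) y (hle4 n) hyY
    have hys' : ∀ n : ℕ, ∃ m i j : ℤ, ys n - q = As (φ n) (((i : ℝ) • Literature.MathematicalPhysics.StatisticalMechanics.triangularVec₁ (bs (φ n))) + ((j : ℝ) • Literature.MathematicalPhysics.StatisticalMechanics.triangularVec₂ (bs (φ n))) + ((Literature.MathematicalPhysics.StatisticalMechanics.haggLabel (ss (φ n)) m : ℝ) • Literature.MathematicalPhysics.StatisticalMechanics.barlowOffset (bs (φ n))) + ((zs (φ n)) m • Literature.MathematicalPhysics.StatisticalMechanics.layerNormal 1)) := fun n => hys n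
    choose ms is_ js hrep using hys'
    -- integer data in the box
    have hbox : ∀ n : ℕ, |ms n| ≤ 7 ∧ |is_ n| ≤ 30 ∧ |js n| ≤ 30 := by
      intro n
      refine intBox (bs (φ n)) ⟨hb1 (φ n), hb2 (φ n)⟩ (As (φ n)) (ss (φ n)) (zs (φ n)) (hss (φ n))
        ⟨hgap (φ n), hz0 (φ n)⟩ (ms n) (is_ n) (js n) ?_
      rw [← hrep n, ← dist_eq_norm]
      have h1' : dist (ys n) q ≤ dist (ys n) y + dist y q := dist_triangle _ _ _
      have h2' : dist (ys n) y ≤ 1 / (((φ n : ℕ) : ℝ) + 1) := by rw [dist_comm]; exact hdy n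
      have h3' : 1 / (((φ n : ℕ) : ℝ) + 1) ≤ 1 := by
        rw [div_le_one (by positivity)]; linarith [(Nat.cast_nonneg (φ n) : (0:ℝ) ≤ (φ n : ℝ))]
      have h4' : dist y q ≤ 3 := by have := hbW.2; linarith
      linarith
    -- pigeonhole on the finite box
    let B : Set (ℤ × ℤ × ℤ) := Set.Icc (-7) 7 ×ˢ (Set.Icc (-30) 30 ×ˢ Set.Icc (-30) 30)
    have hBfin : B.Finite := (Set.finite_Icc _ _).prod ((Set.finite_Icc _ _).prod (Set.finite_Icc _ _))
    have hmemB : ∀ n : ℕ, (ms n, is_ n, js n) ∈ B := by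
      intro n; obtain ⟨hm, hi, hj⟩ := hbox n
      exact ⟨abs_le.1 hm, abs_le.1 hi, abs_le.1 hj⟩
    haveI : Finite B := hBfin.to_subtype
    obtain ⟨⟨t, htB⟩, hinf⟩ := Finite.exists_infinite_fiber (fun n : ℕ => (⟨(ms n, is_ n, js n), hmemB n⟩ : B))
    have hfreq : ∃ᶠ n : ℕ in atTop, (ms n, is_ n, js n) = t := by
      rw [Nat.frequently_atTop_iff_infinite]
      have hinf' := hinf
      rw [Set.infinite_coe_iff] at hinf'
      refine hinf'.mono ?_
      intro n hn
      simp only [Set.mem_preimage, Set.mem_singleton_iff, Subtype.mk.injEq] at hn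
      exact hn
    obtain ⟨m, i, j⟩ := t
    have htm : |m| ≤ 7 := by
      obtain ⟨n, hn⟩ := hfreq.exists
      simp only [Prod.mk.injEq] at hn
      rw [← hn.1]; exact (hbox n).1
    have hP := hconv m i j htm
    -- the limit pattern point equals y - q
    have heq : y - q = A (((i : ℝ) • Literature.MathematicalPhysics.StatisticalMechanics.triangularVec₁ b) + ((j : ℝ) • Literature.MathematicalPhysics.StatisticalMechanics.triangularVec₂ b) + ((Literature.MathematicalPhysics.StatisticalMechanics.haggLabel s m : ℝ) • Literature.MathematicalPhysics.StatisticalMechanics.barlowOffset b) + (z m • Literature.MathematicalPhysics.StatisticalMechanics.layerNormal 1)) := by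
      apply eq_of_forall_dist_le
      intro ε hε
      have hev1 := (Metric.tendsto_nhds.1 hP) (ε / 2) (by positivity)
      have hev2 := (Metric.tendsto_nhds.1 hηt) (ε / 2) (by positivity)
      obtain ⟨n, ⟨hn1, hn2⟩, hn3⟩ := ((hev1.and hev2).and_frequently hfreq).exists
      simp only [Prod.mk.injEq] at hn3
      obtain ⟨hm3, hi3, hj3⟩ := hn3
      have hrepn := hrep n
      rw [hm3, hi3, hj3] at hrepn
      rw [Real.dist_eq, sub_zero, abs_of_pos (hηpos (φ n))] at hn2
      have hd1 : dist (y - q) (ys n - q) ≤ ε / 2 := by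
        rw [dist_eq_norm, sub_sub_sub_cancel_right, ← dist_eq_norm]
        exact le_of_lt (lt_of_le_of_lt (hdy n) hn2)
      have hd2 : dist (ys n - q) (A (((i : ℝ) • Literature.MathematicalPhysics.StatisticalMechanics.triangularVec₁ b) + ((j : ℝ) • Literature.MathematicalPhysics.StatisticalMechanics.triangularVec₂ b) + ((Literature.MathematicalPhysics.StatisticalMechanics.haggLabel s m : ℝ) • Literature.MathematicalPhysics.StatisticalMechanics.barlowOffset b) + (z m • Literature.MathematicalPhysics.StatisticalMechanics.layerNormal 1))) < ε / 2 := by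
        rw [hrepn]; exact hn1
      have := dist_triangle (y - q) (ys n - q) (A (((i : ℝ) • Literature.MathematicalPhysics.StatisticalMechanics.triangularVec₁ b) + ((j : ℝ) • Literature.MathematicalPhysics.StatisticalMechanics.triangularVec₂ b) + ((Literature.MathematicalPhysics.StatisticalMechanics.haggLabel s m : ℝ) • Literature.MathematicalPhysics.StatisticalMechanics.barlowOffset b) + (z m • Literature.MathematicalPhysics.StatisticalMechanics.layerNormal 1)))
      linarith
    exact ⟨m, i, j, heq⟩
  · -- (←) limit pattern point ⟹ configuration point
    obtain ⟨m, i, j, hrep0⟩ := hyP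
    have hm7 : |m| ≤ 7 := by
      refine (intBox b hbW A s z hs ⟨hgz, hzz⟩ m i j ?_).1
      rw [← hrep0, ← dist_eq_norm]; have := hbW.2; linarith
    have hP := hconv m i j hm7
    rw [← hrep0] at hP
    apply sepClosed δ hδ Y hY y
    intro ε hε
    have hev1 := (Metric.tendsto_nhds.1 hP) (ε / 2) (by positivity)
    have hev2 := (Metric.tendsto_nhds.1 hηt) (ε / 2) (by positivity)
    have hlt : ‖y - q‖ < 9 / 2 := by rw [← dist_eq_norm]; have := hbW.2; linarith
    have hev3 := hP.norm.eventually (gt_mem_nhds hlt)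
    obtain ⟨n, ⟨hn1, hn2⟩, hn3⟩ := ((hev1.and hev2).and hev3).exists
    rw [Real.dist_eq, sub_zero, abs_of_pos (hηpos (φ n))] at hn2
    have hmem : (q + As (φ n) (((i : ℝ) • Literature.MathematicalPhysics.StatisticalMechanics.triangularVec₁ (bs (φ n))) + ((j : ℝ) • Literature.MathematicalPhysics.StatisticalMechanics.triangularVec₂ (bs (φ n))) + ((Literature.MathematicalPhysics.StatisticalMechanics.haggLabel (ss (φ n)) m : ℝ) • Literature.MathematicalPhysics.StatisticalMechanics.barlowOffset (bs (φ n))) + ((zs (φ n)) m • Literature.MathematicalPhysics.StatisticalMechanics.layerNormal 1))) - q ∈ {p | ∃ m i j : ℤ, p = As (φ n) (((i : ℝ) • Literature.MathematicalPhysics.StatisticalMechanics.triangularVec₁ (bs (φ n))) + ((j : ℝ) • Literature.MathematicalPhysics.StatisticalMechanics.triangularVec₂ (bs (φ n))) + ((Literature.MathematicalPhysics.StatisticalMechanics.haggLabel (ss (φ n)) m : ℝ) • Literature.MathematicalPhysics.StatisticalMechanics.barlowOffset (bs (φ n))) + ((zs (φ n)) m • Literature.MathematicalPhysics.StatisticalMechanics.layerNormal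 1))} :=
      ⟨m, i, j, by rw [add_sub_cancel_left]⟩
    have hd5 : dist (q + As (φ n) (((i : ℝ) • Literature.MathematicalPhysics.StatisticalMechanics.triangularVec₁ (bs (φ n))) + ((j : ℝ) • Literature.MathematicalPhysics.StatisticalMechanics.triangularVec₂ (bs (φ n))) + ((Literature.MathematicalPhysics.StatisticalMechanics.haggLabel (ss (φ n)) m : ℝ) • Literature.MathematicalPhysics.StatisticalMechanics.barlowOffset (bs (φ n))) + ((zs (φ n)) m • Literature.MathematicalPhysics.StatisticalMechanics.layerNormal 1))) q ≤ 5 * bs (φ n) := by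
      rw [dist_eq_norm, add_sub_cancel_left]
      have := hb1 (φ n)
      exact le_of_lt (lt_of_lt_of_le hn3 (by linarith))
    obtain ⟨x, hxY, hdx⟩ := h2 (φ n) _ hmem hd5
    refine ⟨x, hxY, ?_⟩
    have hd1 : dist x (q + As (φ n) (((i : ℝ) • Literature.MathematicalPhysics.StatisticalMechanics.triangularVec₁ (bs (φ n))) + ((j : ℝ) • Literature.MathematicalPhysics.StatisticalMechanics.triangularVec₂ (bs (φ n))) + ((Literature.MathematicalPhysics.StatisticalMechanics.haggLabel (ss (φ n)) m : ℝ) • Literature.MathematicalPhysics.StatisticalMechanics.barlowOffset (bs (φ n))) + ((zs (φ n)) m • Literature.MathematicalPhysics.StatisticalMechanics.layerNormal 1))) < ε / 2 := lt_of_le_of_lt hdx hn2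
    have hd2 : dist (q + As (φ n) (((i : ℝ) • Literature.MathematicalPhysics.StatisticalMechanics.triangularVec₁ (bs (φ n))) + ((j : ℝ) • Literature.MathematicalPhysics.StatisticalMechanics.triangularVec₂ (bs (φ n))) + ((Literature.MathematicalPhysics.StatisticalMechanics.haggLabel (ss (φ n)) m : ℝ) • Literature.MathematicalPhysics.StatisticalMechanics.barlowOffset (bs (φ n))) + ((zs (φ n)) m • Literature.MathematicalPhysics.StatisticalMechanics.layerNormal 1))) y < ε / 2 := by
      rw [dist_eq_norm, ← sub_sub_sub_cancel_right _ _ q, add_sub_cancel_left, ← dist_eq_norm]; exact hn1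
    have := dist_triangle x (q + As (φ n) (((i : ℝ) • Literature.MathematicalPhysics.StatisticalMechanics.triangularVec₁ (bs (φ n))) + ((j : ℝ) • Literature.MathematicalPhysics.StatisticalMechanics.triangularVec₂ (bs (φ n))) + ((Literature.MathematicalPhysics.StatisticalMechanics.haggLabel (ss (φ n)) m : ℝ) • Literature.MathematicalPhysics.StatisticalMechanics.barlowOffset (bs (φ n))) + ((zs (φ n)) m • Literature.MathematicalPhysics.StatisticalMechanics.layerNormal 1))) y
    linarith

end Summit.AtomisticToContinuum.Crystallization.Theorems.ChartedPlanarOrderWindowExactOfMatched
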